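import Summits.BirchSwinnertonDyer.BirchSwinnertonDyer.Theorems.BiquadraticEisensteinDescentManinDatumSupercuspidalCMInertTorsionCoreOfResolventBoundJZero
import Literature.NumberTheory.EllipticCurves.EisensteinNumberTwistedTorsionSums
import HarnessLib

set_option linter.dupNamespace false -- `Summit.BirchSwinnertonDyer.BirchSwinnertonDyer.Theorems.…` (summit = sub, D-0017)
set_option autoImplicit false

/-!
# Crux `ManinDatumSupercuspidalCMInert` (stmt-BirchSwinnertonDyer-20111, BED r605), stub `stub_S5` (`j = 0` at `p = 5`): the ABSTRACT-WEIGHT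
# CORE of the `j = 0` cell from the pure RESOLVENT BOUND — `Σ_d Φ(d)·E₁(w − t_d; ℤρ + ℤ)` is `ϖ₁·5^{(6−k)/6}`-divisible in the `5 ∤ s`
# currency at every prime-to-`5` torsion point `w`, for every even weight `Φ` on `(ℤ/5)²` with `Φ 0 = 0`, `Σ Φ = 0` and algebraic-integer values

Route `BiquadraticEisensteinDescent` (cell `pub/bsd-wall`, width seat `bsd-wall-cm-bed-w1` g8; `--supports` stmt-BirchSwinnertonDyer-20111,
helper). THEOREMS ONLY (no definition, no named fact, no `sorry`); nothing is closed by this file and BSD is not proved by any of it.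

Fourth CM-side brick of `stub_S5`: the `ℤρ + ℤ` twin of bed-w2 g10's `…StubS7OfResolventBound.core_seven_of_resolventBound`, with the weight kept
ABSTRACT (the tree has no sextic residue symbol `(·/5)₆` on `ℤ[ω]` yet; the day it does, `Φ_k = conj((·/5)₆)^k` discharges `hΦ0`, `hΦneg`
(`(−1/5)₆ = 1`), `hΦsum` (non-trivial character, `k = 1, …, 5`) and `hΦint`, and this file's conclusion is the Bézout-free core `Core₅` that the
`ℤ[ω]` dictionary `H₅ ⟸ T₅` will consume). Composition of

* the lattice-generic algebraization `PeriodPair.sum_mul_eisensteinE₁_sub_eq_varpi_mul` / `…_eq_zero_of_mem` (Literature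
  `EisensteinNumberTwistedTorsionSums`, p641743): `Σ_d Φ(d)E₁(w − t_d; Λ) = ϖ₁·Y(w)·Σ_d Φ(d)/(X(w) − X(t_d))` off the lattice, `= 0` on it;
* the separation / division-point bookkeeping of `…TorsionCoordinatesJZero` (p642033: `t_d = (d₁ρ + d₂)/5`, `t_{−d} + t_d ∈ Λ`, `t_d ∉ Λ` for
  `d ≠ 0`, `℘(w) ≠ ℘(t_d)` for prime-to-`5` torsion `w`);
* the expansion + packaging `…TorsionCoreOfResolventBoundJZero.coreSum_integral_of_resolventBound_rho` (RES₅ ⟹ termwise core).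

* ★ `core_rho_of_resolventBound` — **RES₅ ⟹ abstract Core₅**: for `1 ≤ k ≤ 5`, `Φ : (ℤ/5)² → ℂ` even with `Φ 0 = 0`, `Σ_d Φ(d) = 0`, algebraic-integer
  values, and the resolvent bound `v(Σ_d Φ(d)·X(t_d)⁻ⁿ)⁶ ≤ v(5)^{6−k}` for all `n ≥ 1` at every valuation `v` of `ℂ` with `v 5 < 1`: for EVERY `M′`
  coprime to `5` and EVERY `w` with `M′w ∈ ℤρ + ℤ`, `∃ s ∈ ℕ, 5 ∤ s, s·(Σ_d Φ(d)·E₁(w − t_d; ℤρ + ℤ))/(ϖ₁·5^{(6−k)/6}) ∈ ℤ̄`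
  (`ϖ₁ = 2^{2/3}Γ(1/3)³/(4π)`, `E₁ = PeriodPair.eisensteinE₁`, Rubin's `E₁(z; L)`).

HONEST FRAMING: RES₅ is NOT proved here (certified as exact arithmetic only: kit j310462, memo `Cruxes/…/KIT-RES-CERT-w1g8.md`); the E-side of `stub_S5`
(a `ℤ[ω]` theta dictionary) does not exist yet; nothing here proves the stub, the crux, Manin's conjecture or BSD.
-/

noncomputable section

open scoped Classical
open Complex PeriodPair
open Literature.NumberTheory.EllipticCurves

namespace Summit.BirchSwinnertonDyer.BirchSwinnertonDyer.Theorems.BiquadraticEisensteinDescentManinDatumSupercuspidalCMInertCoreOfResolventBoundJZero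

open Summit.BirchSwinnertonDyer.BirchSwinnertonDyer.Theorems.BiquadraticEisensteinDescentManinDatumSupercuspidalCMInertFiveDivisionEisensteinJZero
  (varpiRho_pos)
open Summit.BirchSwinnertonDyer.BirchSwinnertonDyer.Theorems.BiquadraticEisensteinDescentManinDatumSupercuspidalCMInertTorsionCoordinatesJZero
  (divPointRho_notMem divPointRho_neg_add_mem weierstrassP_ne_divPointRho_of_torsion)
open Summit.BirchSwinnertonDyer.BirchSwinnertonDyer.Theorems.BiquadraticEisensteinDescentManinDatumSupercuspidalCMInertTorsionCoreOfResolventBoundJZero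
  (coreSum_integral_of_resolventBound_rho)

/-- `t_d ∈ Λ` forces `d = 0`. [folklore] -/
theorem eq_zero_of_divPointRho_mem {d : ZMod 5 × ZMod 5}
    (h : ((d.1.val : ℂ) * UpperHalfPlane.ρ + (d.2.val : ℂ)) / 5 ∈ (ofUpperHalfPlane UpperHalfPlane.ρ).lattice) : d = 0 := by
  by_contra hd
  exact divPointRho_notMem hd h

/-- **The twisted `5`-torsion sum on `ℤρ + ℤ` as a rational expression**, for an even weight `Φ` on `(ℤ/5)²` with `Φ 0 = 0` and `Σ Φ = 0`,
at a prime-to-`5` torsion point `w ∉ Λ`: `Σ_d Φ(d)·E₁(w − t_d; Λ) = ϖ₁·Y(w)·Σ_d Φ(d)/(X(w) − X(t_d))`. [cite: Rubin1999, §7.4 Def. 7.11, Prop. 7.12] -/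
theorem torsionSum_rho_eq_varpi_mul (Φ : ZMod 5 × ZMod 5 → ℂ) (hΦ0 : Φ 0 = 0) (hΦneg : ∀ d, Φ (-d) = Φ d)
    (hΦsum : ∑ d, Φ d = 0) {M' : ℕ} (hM5 : Nat.Coprime M' 5) {w : ℂ} (hw : w ∉ (ofUpperHalfPlane UpperHalfPlane.ρ).lattice)
    (hMw : (M' : ℂ) * w ∈ (ofUpperHalfPlane UpperHalfPlane.ρ).lattice) :
    ∑ d : ZMod 5 × ZMod 5, Φ d * (ofUpperHalfPlane UpperHalfPlane.ρ).eisensteinE₁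
        (w - ((d.1.val : ℂ) * UpperHalfPlane.ρ + (d.2.val : ℂ)) / 5) =
      (((2 : ℝ) ^ (2 / 3 : ℝ) * Real.Gamma (1 / 3) ^ 3 / (4 * Real.pi) : ℝ) : ℂ) *
        (℘'[ofUpperHalfPlane UpperHalfPlane.ρ] w / (2 * (((2 : ℝ) ^ (2 / 3 : ℝ) * Real.Gamma (1 / 3) ^ 3 / (4 * Real.pi) : ℝ) : ℂ) ^ 3)) *
        ∑ d : ZMod 5 × ZMod 5, Φ d /
          (℘[ofUpperHalfPlane UpperHalfPlane.ρ] w / (((2 : ℝ) ^ (2 / 3 : ℝ) * Real.Gamma (1 / 3) ^ 3 / (4 * Real.pi) : ℝ) : ℂ) ^ 2 -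
            ℘[ofUpperHalfPlane UpperHalfPlane.ρ] (((d.1.val : ℂ) * UpperHalfPlane.ρ + (d.2.val : ℂ)) / 5) /
              (((2 : ℝ) ^ (2 / 3 : ℝ) * Real.Gamma (1 / 3) ^ 3 / (4 * Real.pi) : ℝ) : ℂ) ^ 2) := by
  have hϖ0 : (((2 : ℝ) ^ (2 / 3 : ℝ) * Real.Gamma (1 / 3) ^ 3 / (4 * Real.pi) : ℝ) : ℂ) ≠ 0 :=
    Complex.ofReal_ne_zero.mpr varpiRho_pos.ne'
  refine (ofUpperHalfPlane UpperHalfPlane.ρ).sum_mul_eisensteinE₁_sub_eq_varpi_mul (Equiv.neg (ZMod 5 × ZMod 5))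
    (fun d ↦ ((d.1.val : ℂ) * UpperHalfPlane.ρ + (d.2.val : ℂ)) / 5) (fun d ↦ ?_) Φ (fun d ↦ ?_) (fun d hd ↦ ?_) hΦsum hw
    (fun d hd ↦ ?_) hϖ0
  · exact divPointRho_neg_add_mem d
  · exact hΦneg d
  · rw [eq_zero_of_divPointRho_mem hd, hΦ0]
  · have hd0 : d ≠ 0 := by
      rintro rfl
      exact hd (by simp)
    exact weierstrassP_ne_divPointRho_of_torsion hM5 hw hMw hd0

/-- **The twisted `5`-torsion sum vanishes at lattice points** (even weight; `E₁` odd and periodic). [cite: Rubin1999, §7.4 Def. 7.11] -/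
theorem torsionSum_rho_eq_zero_of_mem (Φ : ZMod 5 × ZMod 5 → ℂ) (hΦneg : ∀ d, Φ (-d) = Φ d) {w : ℂ}
    (hw : w ∈ (ofUpperHalfPlane UpperHalfPlane.ρ).lattice) :
    ∑ d : ZMod 5 × ZMod 5, Φ d * (ofUpperHalfPlane UpperHalfPlane.ρ).eisensteinE₁
        (w - ((d.1.val : ℂ) * UpperHalfPlane.ρ + (d.2.val : ℂ)) / 5) = 0 :=
  (ofUpperHalfPlane UpperHalfPlane.ρ).sum_mul_eisensteinE₁_sub_eq_zero_of_mem (Equiv.neg (ZMod 5 × ZMod 5))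
    (fun d ↦ ((d.1.val : ℂ) * UpperHalfPlane.ρ + (d.2.val : ℂ)) / 5) (fun d ↦ divPointRho_neg_add_mem d) Φ (fun d ↦ hΦneg d) hw

/-- ★ **RES₅ ⟹ the abstract-weight core of the `j = 0` cell.** Let `1 ≤ k ≤ 5` and let `Φ : (ℤ/5)² → ℂ` be even (`Φ(−d) = Φ(d)`) with `Φ 0 = 0`,
`Σ_d Φ(d) = 0` and algebraic-integer values. Suppose the resolvent bound: for every `n ≥ 1` and every valuation `v` of `ℂ` with `v 5 < 1`,
`v(Σ_d Φ(d)·X(t_d)⁻ⁿ)⁶ ≤ v(5)^{6−k}` (`X = ℘/ϖ₁²`, `t_d = (d₁ρ + d₂)/5`). Then for every `M′` coprime to `5` and every `w` with `M′w ∈ Λ = ℤρ + ℤ`: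
`∃ s ∈ ℕ, 5 ∤ s, s·(Σ_d Φ(d)·E₁(w − t_d; Λ))/(ϖ₁·5^{(6−k)/6}) ∈ ℤ̄`. [cite: Rubin1999, §7.4 Prop. 7.12] [cite: Serre1979, Ch. IV §2 Prop. 7] -/
theorem core_rho_of_resolventBound {k : ℕ} (hk1 : 1 ≤ k) (hk5 : k ≤ 5)
    (Φ : ZMod 5 × ZMod 5 → ℂ) (hΦ0 : Φ 0 = 0) (hΦneg : ∀ d, Φ (-d) = Φ d) (hΦsum : ∑ d, Φ d = 0)
    (hΦint : ∀ d, IsIntegral ℤ (Φ d))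
    (hRES : ∀ n : ℕ, 1 ≤ n → ∀ (Γ₀ : Type) [LinearOrderedCommGroupWithZero Γ₀] (v : Valuation ℂ Γ₀), v 5 < 1 →
      v (∑ d : ZMod 5 × ZMod 5, Φ d *
        (℘[ofUpperHalfPlane UpperHalfPlane.ρ] (((d.1.val : ℂ) * UpperHalfPlane.ρ + (d.2.val : ℂ)) / 5) /
          (((2 : ℝ) ^ (2 / 3 : ℝ) * Real.Gamma (1 / 3) ^ 3 / (4 * Real.pi) : ℝ) : ℂ) ^ 2)⁻¹ ^ n) ^ 6 ≤ v 5 ^ (6 - k))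
    (M' : ℕ) (hM5 : Nat.Coprime M' 5) (w : ℂ) (hMw : (M' : ℂ) * w ∈ (ofUpperHalfPlane UpperHalfPlane.ρ).lattice) :
    ∃ s : ℕ, ¬ 5 ∣ s ∧ IsIntegral ℤ ((s : ℂ) *
      (∑ d : ZMod 5 × ZMod 5, Φ d * (ofUpperHalfPlane UpperHalfPlane.ρ).eisensteinE₁
          (w - ((d.1.val : ℂ) * UpperHalfPlane.ρ + (d.2.val : ℂ)) / 5)) /
        ((((2 : ℝ) ^ (2 / 3 : ℝ) * Real.Gamma (1 / 3) ^ 3 / (4 * Real.pi) : ℝ) : ℂ) * (5 : ℂ) ^ (((6 - k : ℕ) : ℂ) / 6))) := by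
  by_cases hw : w ∈ (ofUpperHalfPlane UpperHalfPlane.ρ).lattice
  · refine ⟨1, by norm_num, ?_⟩
    rw [torsionSum_rho_eq_zero_of_mem Φ hΦneg hw, mul_zero, zero_div]
    exact isIntegral_zero
  · obtain ⟨s, hs, hint⟩ := coreSum_integral_of_resolventBound_rho hk1 hk5 Φ hΦ0 hΦint hw hMw hM5 hRES
    refine ⟨s, hs, ?_⟩
    have hϖ0 : (((2 : ℝ) ^ (2 / 3 : ℝ) * Real.Gamma (1 / 3) ^ 3 / (4 * Real.pi) : ℝ) : ℂ) ≠ 0 :=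
      Complex.ofReal_ne_zero.mpr varpiRho_pos.ne'
    have hρ0 : (5 : ℂ) ^ (((6 - k : ℕ) : ℂ) / 6) ≠ 0 := by
      intro h; have := (Complex.cpow_eq_zero_iff _ _).mp h; norm_num at this
    have key : ∀ (a b c d e : ℂ), b ≠ 0 → e ≠ 0 → a * (b * c * d) / (b * e) = a * (c * d / e) := by
      intro a b c d e hb he; field_simp
    rw [torsionSum_rho_eq_varpi_mul Φ hΦ0 hΦneg hΦsum hM5 hw hMw, key _ _ _ _ _ hϖ0 hρ0]
    exact hint

end Summit.BirchSwinnertonDyer.BirchSwinnertonDyer.Theorems.BiquadraticEisensteinDescentManinDatumSupercuspidalCMInertCoreOfResolventBoundJZero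

end
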